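import Summits.AtomisticToContinuum.HydrodynamicLimit.Theorems.OneSphereInfluenceStaticScoreResponseGaussMoments
import Literature.MathematicalPhysics.KineticTheory.HardSphereEuler
import HarnessLib

/-!
# The local-Maxwellian mean of the orthogonal currents is second order in the parameter deviations (statics of the kinetic heart P3Λ; line `Sketch`, crux stmt-11854)

Support file (`--supports stmt-AtomisticToContinuum-11854`).  The kinetic heart `…LambertianEulerHearts.KineticOneBlockInMeanLambda`
(P3Λ) asks for the mean, along the Lambertian gas, of the FAST (orthogonal) kinetic current
`Y⊥(c) = θ⁻¹ Σ_{jk} (c_j c_k − δ_{jk}|c|²/3) A_{jk} + (|c|² − 5θ)(c·a)/(2θ²)`, `c = v − u`, `A = ∇u`, `a = ∇θ`, of the REFERENCE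
profiles `(u, θ)`.  Why this is the right object (lead c6's dissection, `Cruxes/LambertianEuler/Lines/Sketch.md` §c6.3): under a
Maxwellian velocity law with ANY parameters `(u′, θ′)` — i.e. `v = u′ + √θ′ ξ`, `ξ` standard Gaussian — the mean of `Y⊥` is
`θ⁻¹ Σ_{jk} (δ_j δ_k − δ_{jk}|δ|²/3) A_{jk} + (5(θ′ − θ) + |δ|²)(δ·a)/(2θ²)`, `δ = u′ − u` (`integral_orthogonalCurrents_affine`):
it VANISHES TO FIRST ORDER in `(u′ − u, θ′ − θ)` for every matrix `A` (the isotropic `θ′ tr A` terms cancel) and every `a` (odd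
moments), so inside a window of length `h` the Euler drift of the reference profiles costs only `O(h²)N` in the mean of the fast
current — summable over `t/h` windows.  This is the static identity behind Yau's choice of entropy variables; the dynamical input
left for P3Λ is decorrelation of the peculiar-velocity quadratic form by the Lambertian contacts (KCW-Λ).  Tools: the moments of
independent standard normals (`…StaticScoreResponseGaussMoments`).  Lead prover-line-stmt-AtomisticToContinuum-11854-c6-0, 2026-08-17.
-/

noncomputable section

namespace Summit.AtomisticToContinuum.HydrodynamicLimit.Theorems.LambertianContactSwapLambertianEulerOrthogonalCurrentsMean

open MeasureTheory ProbabilityTheory Finset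
open scoped ENNReal InnerProductSpace
open Literature.MathematicalPhysics.KineticTheory
open Summit.AtomisticToContinuum.HydrodynamicLimit.Theorems

/-! ## §1 Affine moments of independent standard normals on `ℝ³` -/

/-- `E[s x_k + d_k] = d_k`. [folklore] -/
theorem integral_affine_pi (s : ℝ) (d : Fin 3 → ℝ) (k : Fin 3) :
    ∫ x, (s * x k + d k) ∂Measure.pi (fun _ : Fin 3 => gaussianReal 0 1) = d k := by
  have h1 : ∀ x : Fin 3 → ℝ, s * x k + d k = s * (x k) ^ 1 + d k := fun x => by ring
  simp_rw [h1]
  rw [integral_add ((integrable_coord_pow_pi k 1).const_mul s) (integrable_const _), integral_const_mul,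
    integral_coord_pow_pi, moment_one_gaussianReal, integral_const, probReal_univ]
  simp

/-- `E[(s x_j + d_j)(s x_k + d_k)] = s² δ_{jk} + d_j d_k`. [folklore] -/
theorem integral_affine_mul_affine_pi (s : ℝ) (d : Fin 3 → ℝ) (j k : Fin 3) :
    ∫ x, (s * x j + d j) * (s * x k + d k) ∂Measure.pi (fun _ : Fin 3 => gaussianReal 0 1) =
      s ^ 2 * (if j = k then 1 else 0) + d j * d k := by
  have h1 : ∀ x : Fin 3 → ℝ, (s * x j + d j) * (s * x k + d k) =
      s ^ 2 * ((x j) ^ 1 * (x k) ^ 1) + (s * d k * (x j) ^ 1 + (s * d j * (x k) ^ 1 + d j * d k)) := fun x => by ring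
  simp_rw [h1]
  have i1 := (integrable_coord_pow_mul_coord_pow_pi (ι := Fin 3) j k 1 1).const_mul (s ^ 2)
  have i2 := (integrable_coord_pow_pi (ι := Fin 3) j 1).const_mul (s * d k)
  have i3 := (integrable_coord_pow_pi (ι := Fin 3) k 1).const_mul (s * d j)
  have i4 : Integrable (fun _ : Fin 3 → ℝ => d j * d k) (Measure.pi (fun _ : Fin 3 => gaussianReal 0 1)) :=
    integrable_const _
  have i34 : Integrable (fun x : Fin 3 → ℝ => s * d j * (x k) ^ 1 + d j * d k)
      (Measure.pi (fun _ : Fin 3 => gaussianReal 0 1)) := i3.add i4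
  have i234 : Integrable (fun x : Fin 3 → ℝ => s * d k * (x j) ^ 1 + (s * d j * (x k) ^ 1 + d j * d k))
      (Measure.pi (fun _ : Fin 3 => gaussianReal 0 1)) := i2.add i34
  rw [integral_add i1 i234, integral_add i2 i34, integral_add i3 i4,
    integral_const_mul, integral_const_mul, integral_const_mul, integral_coord_mul_coord_pi,
    integral_coord_pow_pi, integral_coord_pow_pi, moment_one_gaussianReal, integral_const, probReal_univ]
  simp

/-- `E[(s x_l + d_l)²(s x_k + d_k)] = s² d_k + 2 s² d_l δ_{lk} + d_l² d_k`. [folklore] -/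
theorem integral_affine_sq_mul_affine_pi (s : ℝ) (d : Fin 3 → ℝ) (l k : Fin 3) :
    ∫ x, (s * x l + d l) ^ 2 * (s * x k + d k) ∂Measure.pi (fun _ : Fin 3 => gaussianReal 0 1) =
      s ^ 2 * d k + 2 * s ^ 2 * d l * (if l = k then 1 else 0) + d l ^ 2 * d k := by
  have h1 : ∀ x : Fin 3 → ℝ, (s * x l + d l) ^ 2 * (s * x k + d k) =
      s ^ 3 * ((x l) ^ 2 * (x k) ^ 1) + (s ^ 2 * d k * ((x l) ^ 1 * (x l) ^ 1) +
        (2 * s ^ 2 * d l * ((x l) ^ 1 * (x k) ^ 1) + (2 * s * d l * d k * (x l) ^ 1 +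
          (s * d l ^ 2 * (x k) ^ 1 + d l ^ 2 * d k)))) := fun x => by ring
  simp_rw [h1]
  have i1 := (integrable_coord_pow_mul_coord_pow_pi (ι := Fin 3) l k 2 1).const_mul (s ^ 3)
  have i2 := (integrable_coord_pow_mul_coord_pow_pi (ι := Fin 3) l l 1 1).const_mul (s ^ 2 * d k)
  have i3 := (integrable_coord_pow_mul_coord_pow_pi (ι := Fin 3) l k 1 1).const_mul (2 * s ^ 2 * d l)
  have i4 := (integrable_coord_pow_pi (ι := Fin 3) l 1).const_mul (2 * s * d l * d k)
  have i5 := (integrable_coord_pow_pi (ι := Fin 3) k 1).const_mul (s * d l ^ 2)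
  have i6 : Integrable (fun _ : Fin 3 → ℝ => d l ^ 2 * d k) (Measure.pi (fun _ : Fin 3 => gaussianReal 0 1)) :=
    integrable_const _
  have i56 : Integrable (fun x : Fin 3 → ℝ => s * d l ^ 2 * (x k) ^ 1 + d l ^ 2 * d k)
      (Measure.pi (fun _ : Fin 3 => gaussianReal 0 1)) := i5.add i6
  have i456 : Integrable (fun x : Fin 3 → ℝ => 2 * s * d l * d k * (x l) ^ 1 + (s * d l ^ 2 * (x k) ^ 1 + d l ^ 2 * d k))
      (Measure.pi (fun _ : Fin 3 => gaussianReal 0 1)) := i4.add i56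
  have i3456 : Integrable (fun x : Fin 3 → ℝ => 2 * s ^ 2 * d l * ((x l) ^ 1 * (x k) ^ 1) +
      (2 * s * d l * d k * (x l) ^ 1 + (s * d l ^ 2 * (x k) ^ 1 + d l ^ 2 * d k)))
      (Measure.pi (fun _ : Fin 3 => gaussianReal 0 1)) := i3.add i456
  have i23456 : Integrable (fun x : Fin 3 → ℝ => s ^ 2 * d k * ((x l) ^ 1 * (x l) ^ 1) +
      (2 * s ^ 2 * d l * ((x l) ^ 1 * (x k) ^ 1) +
        (2 * s * d l * d k * (x l) ^ 1 + (s * d l ^ 2 * (x k) ^ 1 + d l ^ 2 * d k))))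
      (Measure.pi (fun _ : Fin 3 => gaussianReal 0 1)) := i2.add i3456
  rw [integral_add i1 i23456, integral_add i2 i3456, integral_add i3 i456, integral_add i4 i56, integral_add i5 i6,
    integral_const_mul, integral_const_mul, integral_const_mul, integral_const_mul, integral_const_mul,
    integral_coord_sq_mul_coord_pi, integral_coord_mul_coord_pi, integral_coord_mul_coord_pi,
    integral_coord_pow_pi, integral_coord_pow_pi, moment_one_gaussianReal, integral_const, probReal_univ]
  by_cases hlk : l = k
  · simp only [hlk, ↓reduceIte, mul_one, mul_zero]
    ring
  · simp only [hlk, ↓reduceIte, mul_one, mul_zero, add_zero]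
    ring

/-! ## §2 The mean of the orthogonal currents under an affine image of the standard Gaussian -/

/-- **The local-Maxwellian mean of the fast kinetic current is second order in the deviations** (registered sub-goal
`integral_orthogonalCurrents_affine` of stmt-11854).  For `θ, θ′ ∈ ℝ`, `0 ≤ θ′`, a matrix `A`, a covector `a` and `δ ∈ ℝ³`, with
`c(ξ) = √θ′ ξ + δ` (the peculiar velocity, relative to the reference `u`, of a Maxwellian velocity `u′ + √θ′ ξ`, `δ = u′ − u`):
`E[θ⁻¹ Σ_{jk} (c_j c_k − δ_{jk}|c|²/3) A_{jk} + (|c|² − 5θ)(Σ_k c_k a_k)/(2θ²)] = θ⁻¹ Σ_{jk} (δ_j δ_k − δ_{jk}|δ|²/3) A_{jk} +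
(5(θ′ − θ) + |δ|²)(Σ_k δ_k a_k)/(2θ²)`.  (The integrand is written exactly as in the kinetic heart P3Λ, with `A j k = ∂_k u_j`,
`a k = ∂_k θ`.) [folklore] -/
theorem integral_orthogonalCurrents_affine : ∀ (θ θ' : ℝ), 0 ≤ θ' → ∀ (A : Fin 3 → Fin 3 → ℝ) (a : Fin 3 → ℝ) (δ : V3),
    ∫ ξ, (θ⁻¹ * ∑ j : Fin 3, ∑ k : Fin 3, (((Real.sqrt θ' • ξ + δ) j * (Real.sqrt θ' • ξ + δ) k -
          (if j = k then ‖Real.sqrt θ' • ξ + δ‖ ^ 2 / 3 else 0)) * A j k) +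
        (‖Real.sqrt θ' • ξ + δ‖ ^ 2 - 5 * θ) * (∑ k : Fin 3, (Real.sqrt θ' • ξ + δ) k * a k) / (2 * θ ^ 2))
      ∂stdGaussian V3 =
    θ⁻¹ * ∑ j : Fin 3, ∑ k : Fin 3, ((δ j * δ k - (if j = k then ‖δ‖ ^ 2 / 3 else 0)) * A j k) +
      (5 * (θ' - θ) + ‖δ‖ ^ 2) * (∑ k : Fin 3, δ k * a k) / (2 * θ ^ 2) := by
  intro θ θ' hθ' A a δ
  set s := Real.sqrt θ' with hs
  have hs2 : s ^ 2 = θ' := Real.sq_sqrt hθ'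
  -- coordinates of the affine image and the squared norm in coordinates
  have hcoord : ∀ (ξ : V3) (j : Fin 3), (s • ξ + δ) j = s * ξ j + δ j := fun ξ j => by
    simp [PiLp.add_apply, PiLp.smul_apply, smul_eq_mul]
  have hnorm : ∀ ξ : V3, ‖s • ξ + δ‖ ^ 2 = ∑ l : Fin 3, (s * ξ l + δ l) ^ 2 := fun ξ => by
    rw [norm_sq_eq_sum_sq]; exact Finset.sum_congr rfl fun l _ => by rw [hcoord]
  have hnormδ : ‖δ‖ ^ 2 = ∑ l : Fin 3, (δ l) ^ 2 := norm_sq_eq_sum_sq δ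
  -- the integrand as an explicit polynomial in the coordinates (all sums over `Fin 3` expanded)
  have hpoint : ∀ ξ : V3,
      (θ⁻¹ * ∑ j : Fin 3, ∑ k : Fin 3, (((s • ξ + δ) j * (s • ξ + δ) k -
          (if j = k then ‖s • ξ + δ‖ ^ 2 / 3 else 0)) * A j k) +
        (‖s • ξ + δ‖ ^ 2 - 5 * θ) * (∑ k : Fin 3, (s • ξ + δ) k * a k) / (2 * θ ^ 2)) =
      θ⁻¹ * (∑ j : Fin 3, ∑ k : Fin 3, A j k * ((s * ξ j + δ j) * (s * ξ k + δ k))) -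
        θ⁻¹ * ((∑ j : Fin 3, A j j) / 3) * (∑ l : Fin 3, (s * ξ l + δ l) * (s * ξ l + δ l)) +
        (2 * θ ^ 2)⁻¹ * (∑ l : Fin 3, ∑ k : Fin 3, a k * ((s * ξ l + δ l) ^ 2 * (s * ξ k + δ k))) -
        (2 * θ ^ 2)⁻¹ * (5 * θ) * (∑ k : Fin 3, a k * (s * ξ k + δ k)) := by
    intro ξ
    simp only [hcoord, hnorm, Fin.sum_univ_three, Fin.isValue]
    simp only [show ((0 : Fin 3) = 1) = False by decide, show ((0 : Fin 3) = 2) = False by decide,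
      show ((1 : Fin 3) = 0) = False by decide, show ((1 : Fin 3) = 2) = False by decide,
      show ((2 : Fin 3) = 0) = False by decide, show ((2 : Fin 3) = 1) = False by decide, if_true, if_false]
    ring
  -- measurability of the polynomial integrand on `V3`
  have hmc : ∀ j : Fin 3, Measurable fun ξ : V3 => s * ξ j + δ j := fun j =>
    (measurable_const.mul (PiLp.continuous_apply 2 _ j).measurable).add measurable_const
  have hmeas : Measurable fun ξ : V3 =>
      θ⁻¹ * (∑ j : Fin 3, ∑ k : Fin 3, A j k * ((s * ξ j + δ j) * (s * ξ k + δ k))) -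
        θ⁻¹ * ((∑ j : Fin 3, A j j) / 3) * (∑ l : Fin 3, (s * ξ l + δ l) * (s * ξ l + δ l)) +
        (2 * θ ^ 2)⁻¹ * (∑ l : Fin 3, ∑ k : Fin 3, a k * ((s * ξ l + δ l) ^ 2 * (s * ξ k + δ k))) -
        (2 * θ ^ 2)⁻¹ * (5 * θ) * (∑ k : Fin 3, a k * (s * ξ k + δ k)) := by
    refine (((measurable_const.mul ?_).sub ((measurable_const).mul ?_)).add (measurable_const.mul ?_)).sub
      (measurable_const.mul ?_)
    · exact Finset.measurable_sum _ fun j _ => Finset.measurable_sum _ fun k _ =>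
        measurable_const.mul ((hmc j).mul (hmc k))
    · exact Finset.measurable_sum _ fun l _ => (hmc l).mul (hmc l)
    · exact Finset.measurable_sum _ fun l _ => Finset.measurable_sum _ fun k _ =>
        measurable_const.mul (((hmc l).pow_const 2).mul (hmc k))
    · exact Finset.measurable_sum _ fun k _ => measurable_const.mul (hmc k)
  simp_rw [hpoint]
  rw [integral_stdGaussian_eq_pi hmeas]
  dsimp only
  -- integrate term by term
  set P : Measure (Fin 3 → ℝ) := Measure.pi (fun _ : Fin 3 => gaussianReal 0 1) with hP
  have iM2 : ∀ j k : Fin 3, Integrable (fun x : Fin 3 → ℝ => (s * x j + δ j) * (s * x k + δ k)) P := by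
    intro j k
    have h1 : (fun x : Fin 3 → ℝ => (s * x j + δ j) * (s * x k + δ k)) = fun x =>
        s ^ 2 * ((x j) ^ 1 * (x k) ^ 1) + (s * δ k * (x j) ^ 1 + (s * δ j * (x k) ^ 1 + δ j * δ k)) := by
      funext x; ring
    rw [h1]
    exact ((integrable_coord_pow_mul_coord_pow_pi j k 1 1).const_mul _).add
      (((integrable_coord_pow_pi j 1).const_mul _).add (((integrable_coord_pow_pi k 1).const_mul _).add
        (integrable_const _)))
  have iM3 : ∀ l k : Fin 3, Integrable (fun x : Fin 3 → ℝ => (s * x l + δ l) ^ 2 * (s * x k + δ k)) P := by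
    intro l k
    have h1 : (fun x : Fin 3 → ℝ => (s * x l + δ l) ^ 2 * (s * x k + δ k)) = fun x =>
        s ^ 3 * ((x l) ^ 2 * (x k) ^ 1) + (s ^ 2 * δ k * ((x l) ^ 1 * (x l) ^ 1) +
          (2 * s ^ 2 * δ l * ((x l) ^ 1 * (x k) ^ 1) + (2 * s * δ l * δ k * (x l) ^ 1 +
            (s * δ l ^ 2 * (x k) ^ 1 + δ l ^ 2 * δ k)))) := by
      funext x; ring
    rw [h1]
    exact ((integrable_coord_pow_mul_coord_pow_pi l k 2 1).const_mul _).add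
      (((integrable_coord_pow_mul_coord_pow_pi l l 1 1).const_mul _).add
        (((integrable_coord_pow_mul_coord_pow_pi l k 1 1).const_mul _).add
          (((integrable_coord_pow_pi l 1).const_mul _).add (((integrable_coord_pow_pi k 1).const_mul _).add
            (integrable_const _)))))
  have iM1 : ∀ k : Fin 3, Integrable (fun x : Fin 3 → ℝ => s * x k + δ k) P := fun k => by
    have h1 : (fun x : Fin 3 → ℝ => s * x k + δ k) = fun x => s * (x k) ^ 1 + δ k := by funext x; ring
    rw [h1]
    exact ((integrable_coord_pow_pi k 1).const_mul s).add (integrable_const _)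
  have iT1 : Integrable (fun x : Fin 3 → ℝ => ∑ j : Fin 3, ∑ k : Fin 3, A j k * ((s * x j + δ j) * (s * x k + δ k))) P :=
    integrable_finsetSum _ fun j _ => integrable_finsetSum _ fun k _ => (iM2 j k).const_mul _
  have iT2 : Integrable (fun x : Fin 3 → ℝ => ∑ l : Fin 3, (s * x l + δ l) * (s * x l + δ l)) P :=
    integrable_finsetSum _ fun l _ => iM2 l l
  have iT3 : Integrable (fun x : Fin 3 → ℝ => ∑ l : Fin 3, ∑ k : Fin 3, a k * ((s * x l + δ l) ^ 2 * (s * x k + δ k))) P :=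
    integrable_finsetSum _ fun l _ => integrable_finsetSum _ fun k _ => (iM3 l k).const_mul _
  have iT4 : Integrable (fun x : Fin 3 → ℝ => ∑ k : Fin 3, a k * (s * x k + δ k)) P :=
    integrable_finsetSum _ fun k _ => (iM1 k).const_mul _
  have j1 : Integrable (fun x : Fin 3 → ℝ =>
      θ⁻¹ * ∑ j : Fin 3, ∑ k : Fin 3, A j k * ((s * x j + δ j) * (s * x k + δ k))) P := iT1.const_mul _
  have j2 : Integrable (fun x : Fin 3 → ℝ =>
      θ⁻¹ * ((∑ j : Fin 3, A j j) / 3) * ∑ l : Fin 3, (s * x l + δ l) * (s * x l + δ l)) P := iT2.const_mul _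
  have j3 : Integrable (fun x : Fin 3 → ℝ =>
      (2 * θ ^ 2)⁻¹ * ∑ l : Fin 3, ∑ k : Fin 3, a k * ((s * x l + δ l) ^ 2 * (s * x k + δ k))) P := iT3.const_mul _
  have j4 : Integrable (fun x : Fin 3 → ℝ =>
      (2 * θ ^ 2)⁻¹ * (5 * θ) * ∑ k : Fin 3, a k * (s * x k + δ k)) P := iT4.const_mul _
  have j12 : Integrable (fun x : Fin 3 → ℝ =>
      θ⁻¹ * (∑ j : Fin 3, ∑ k : Fin 3, A j k * ((s * x j + δ j) * (s * x k + δ k))) -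
        θ⁻¹ * ((∑ j : Fin 3, A j j) / 3) * ∑ l : Fin 3, (s * x l + δ l) * (s * x l + δ l)) P := j1.sub j2
  have j123 : Integrable (fun x : Fin 3 → ℝ =>
      θ⁻¹ * (∑ j : Fin 3, ∑ k : Fin 3, A j k * ((s * x j + δ j) * (s * x k + δ k))) -
        θ⁻¹ * ((∑ j : Fin 3, A j j) / 3) * (∑ l : Fin 3, (s * x l + δ l) * (s * x l + δ l)) +
        (2 * θ ^ 2)⁻¹ * ∑ l : Fin 3, ∑ k : Fin 3, a k * ((s * x l + δ l) ^ 2 * (s * x k + δ k))) P := j12.add j3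
  rw [integral_sub j123 j4, integral_add j12 j3, integral_sub j1 j2,
    integral_const_mul, integral_const_mul, integral_const_mul, integral_const_mul]
  rw [integral_finsetSum _ fun j _ => integrable_finsetSum _ fun k _ => (iM2 j k).const_mul _]
  rw [Finset.sum_congr rfl fun j _ => integral_finsetSum _ fun k _ => (iM2 j k).const_mul _]
  rw [integral_finsetSum _ fun l _ => iM2 l l]
  rw [integral_finsetSum _ fun l _ => integrable_finsetSum _ fun k _ => (iM3 l k).const_mul _]
  rw [Finset.sum_congr rfl fun l _ => integral_finsetSum _ fun k _ => (iM3 l k).const_mul _]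
  rw [integral_finsetSum _ fun k _ => (iM1 k).const_mul _]
  simp_rw [integral_const_mul]
  simp only [hP, integral_affine_mul_affine_pi, integral_affine_sq_mul_affine_pi, integral_affine_pi]
  -- the remaining algebra
  simp only [hnormδ, hs2, Fin.sum_univ_three, Fin.isValue]
  simp only [show ((0 : Fin 3) = 1) = False by decide, show ((0 : Fin 3) = 2) = False by decide,
    show ((1 : Fin 3) = 0) = False by decide, show ((1 : Fin 3) = 2) = False by decide,
    show ((2 : Fin 3) = 0) = False by decide, show ((2 : Fin 3) = 1) = False by decide, if_true, if_false]
  ring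

end Summit.AtomisticToContinuum.HydrodynamicLimit.Theorems.LambertianContactSwapLambertianEulerOrthogonalCurrentsMean
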